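import Summits.RiemannHypothesis.RiemannHypothesis.Theorems.Splittings.ZdReferencePinsFrame
import Literature.NumberTheory.LFunctions.SelbergArgOmegaProofs
import Summits.RiemannHypothesis.RiemannHypothesis.Theorems.Splittings.ZdTwoHeightMeanSquare
import HarnessLib

/-!
# Continuous-reference pins of `S(t)` (zd-neg g10 §2): VALID splittings in the trivial direction, CLOSED by Selberg Ω±

Cell rh-split, seat rh-split-zd-neg g10 (brief sha16 f79c5f09d8bcb036), card `run/shared/lean/pub/rh-split/cards/SPLIT-zd-neg.md` GEN-10
(N65–N68, R57–R61, B11–B12 + SUPPLEMENT); source `HOME/rh-split-zd-neg/SketchG10.lean` v2 sha16 29368ce59f30369a (namespace `RhSplitZdNegG10`),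
referee rh-split-ref-2 g0: GEN-10 REPLAY PASS on kernel v2 + CONTENT read-backs R1–R10 + LABELS N65–N68 UPHELD (2026-08-27T09:34:25Z, `INBOX.md`);
lead rh-split-lead g3; CARVE MAP + CUT.md in `HOME/rh-split-zd-neg/carve-g10/`.  Deltas vs the source (CUT.md): namespace ↦ `…Splittings.<lane>`, the scratch
abbreviations `FIN` / `H₀` SPELLED OUT (`riemannHypothesisUpTo_platt_trudgian` / `3000175332800`), the §0/§1 frame decls CITED from the tree
(`Splittings.ZdReferencePinsFrame`: `RHAbove`, `rh_of_fin_of_rhAbove`, `rhAbove_of_rh`, `two_le_count_jump`, `zetaArgS_sub`) instead of restated,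
`primesLE_mono` ↦ Mathlib `Nat.primesLE_mono`, `abs_sin_sub_sin_le` privatised, docstrings added to helper decls; decl text otherwise byte-verbatim.

CONTENT (count side of the zd splitting search, continued from lane (x-c)): a «reference pin» `|S(t) − R(t)| < 1` above a height, for a reference `R`
continuous from the left at zero ordinates, forbids a jump `≥ 2` of `N`, hence off-line pairs and multiple zeros above that height — a VALID
partner of `riemannHypothesisUpTo_platt_trudgian`; but `S = Ω±((log t)^{1/3}/(log log t)^{7/3})` (tree `Selberg1946_zetaArgS_omega_holds`) refutes every bounded,
one-signed, eventually monotone-dominated or fixed-scale reference unconditionally. LABELS (proposed to the referee): RH-FREE kernel bookkeeping /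
refutations; class (zd, neg) UNCHANGED = BARRIER NOTE, 0 survivors.

This file: §1⁺ the multiplicity form of the jump lemma (`two_le_count_jump_of_two_le_order`), §2 `RefPin H R` (N67): `count_jump_lt_two_of_refPin`,
`rhAbove_of_refPin`, `order_eq_one_of_refPin`, `rh_of_fin_of_refPin` (VALID for every reference `R`), and the FIN-free refutations of every
one-sidedly dominated reference (`not_refPin_of_eventually_le/ge`, `not_refPin_const`, `…_tendsto_atTop/atBot`, `not_refPin_arg`, `refPin_residue`).

HONEST LABEL: «SPLITTING SEARCH over kernel-typed RH-EQUIVALENCES; a splitting A ∧ B ⟹ RH is CONDITIONAL bookkeeping unless A and B are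
both proved; nothing here bears on the truth of RH.»
-/

set_option linter.dupNamespace false

noncomputable section

open Filter Complex Metric Set
open scoped Real Topology

namespace Summit.RiemannHypothesis.RiemannHypothesis.Theorems.Splittings.ZdPrimePin

open Literature.NumberTheory.DiophantineGeometry Literature.NumberTheory.LFunctions
  Literature.Barriers.RiemannHypothesis MeasureTheory
open Summit.RiemannHypothesis.RiemannHypothesis.Theorems.Splittings.ZdReferencePins (RHAbove
  rh_of_fin_of_rhAbove rhAbove_of_rh two_le_count_jump zetaArgS_sub)
open Summit.RiemannHypothesis.RiemannHypothesis.Theorems.Splittings.ZdTwoHeightMeanSquare (primeSin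
  continuous_primeSin' im_sq_integral_ge primesLE_subset_Icc_sq sizes_aux intervalIntegrable_selbergE_sq)

/-! ## §1⁺ Jump machinery, multiplicity form (the pair form `two_le_count_jump` and `zetaArgS_sub` are the tree's, lane (x-c)) -/

/-- NEW: a zero of multiplicity `≥ 2` with ordinate `γ > 0` also makes `N` jump by `≥ 2` across `γ`. -/
theorem two_le_count_jump_of_two_le_order {s : ℂ} (hs : riemannZeta s = 0) (h0 : 0 < s.im)
    (hre : 0 ≤ s.re ∧ s.re ≤ 1) (hord : (2 : ℤ) ≤ riemannZetaZeroOrder s) {t : ℝ} (ht : t < s.im) :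
    (2 : ℝ) ≤ (zetaZeroCount s.im : ℝ) - zetaZeroCount t := by
  classical
  unfold zetaZeroCount
  rw [zetaZeroCountRe_sub_eq_sum 0 ht.le]
  have hmem : s ∈ (zetaZeroBox_finite 0 s.im).toFinset \ (zetaZeroBox_finite 0 t).toFinset := by
    rw [Finset.mem_sdiff, Set.Finite.mem_toFinset, Set.Finite.mem_toFinset]
    refine ⟨⟨hs, hre.1, hre.2, h0, le_rfl⟩, ?_⟩
    rintro ⟨-, -, -, -, h5⟩
    exact absurd h5 (not_le.2 ht)
  have hsub : ({s} : Finset ℂ) ⊆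
      (zetaZeroBox_finite 0 s.im).toFinset \ (zetaZeroBox_finite 0 t).toFinset :=
    Finset.singleton_subset_iff.2 hmem
  calc (2 : ℝ) ≤ (riemannZetaZeroOrder s : ℝ) := by exact_mod_cast hord
    _ = ∑ u ∈ ({s} : Finset ℂ), (riemannZetaZeroOrder u : ℝ) := by rw [Finset.sum_singleton]
    _ ≤ ∑ ρ ∈ (zetaZeroBox_finite 0 s.im).toFinset \ (zetaZeroBox_finite 0 t).toFinset,
          (riemannZetaZeroOrder ρ : ℝ) :=
        Finset.sum_le_sum_of_subset_of_nonneg hsub fun u hu _ ↦ Int.cast_nonneg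
          (riemannZetaZeroOrder_nonneg (ne_one_of_riemannZeta_eq_zero (mem_sdiff_zetaZeroBox hu).1))

/-! ## §2 Continuous-reference pins -/

/-- `RefPin H R`: above `H`, `S(t)` stays within `1` of the reference value `R(t)`. (`R ≡ 0` is N7.) -/
def RefPin (H : ℝ) (R : ℝ → ℝ) : Prop :=
  ∀ t : ℝ, H ≤ t → |zetaArgS t - R t| < 1

/-- **The moving-reference jump principle.** If `R` is continuous on `[H, ∞)` (`H ≥ 0`) and
`RefPin H R` holds, then across every height `γ > H` the counting function jumps by `< 2`:
there is `δ > 0` with `H ≤ γ − δ` and `N(γ) − N(γ − δ) < 2`. -/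
theorem count_jump_lt_two_of_refPin {H : ℝ} {R : ℝ → ℝ} (hR : ContinuousOn R (Set.Ici H))
    (h : RefPin H R) {γ : ℝ} (hγ : H < γ) :
    ∃ δ : ℝ, 0 < δ ∧ H ≤ γ - δ ∧ (zetaZeroCount γ : ℝ) - zetaZeroCount (γ - δ) < 2 := by
  -- margin at height `γ`
  have hSγ := (abs_lt.1 (h γ hγ.le)).2
  obtain ⟨κ, hκ⟩ : ∃ κ : ℝ, κ = R γ + 1 - zetaArgS γ := ⟨_, rfl⟩
  have hκpos : 0 < κ := by linarith
  -- continuity of `θ` at `γ`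
  obtain ⟨δ₀, hδ₀, hθ⟩ :=
    Metric.continuous_iff.1 continuous_riemannSiegelTheta γ (π * (κ / 2)) (by positivity)
  -- continuity of `R` at `γ` within `[H, ∞)`
  have hRγ : ContinuousWithinAt R (Set.Ici H) γ := hR γ hγ.le
  obtain ⟨δ₁, hδ₁, hRc⟩ := (Metric.continuousWithinAt_iff.1 hRγ) (κ / 2) (by positivity)
  obtain ⟨δ, hδpos, hδ₀', hδ₁', hδH⟩ :
      ∃ δ : ℝ, 0 < δ ∧ δ < δ₀ ∧ δ < δ₁ ∧ H ≤ γ - δ := by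
    refine ⟨min (min (δ₀ / 2) (δ₁ / 2)) ((γ - H) / 2), ?_, ?_, ?_, ?_⟩
    · exact lt_min (lt_min (by linarith) (by linarith)) (by linarith)
    · have := (min_le_left (min (δ₀ / 2) (δ₁ / 2)) ((γ - H) / 2)).trans (min_le_left _ _)
      linarith
    · have := (min_le_left (min (δ₀ / 2) (δ₁ / 2)) ((γ - H) / 2)).trans (min_le_right _ _)
      linarith
    · linarith [min_le_right (min (δ₀ / 2) (δ₁ / 2)) ((γ - H) / 2)]
  refine ⟨δ, hδpos, hδH, ?_⟩
  -- at height `γ − δ`: `S(γ − δ) > R(γ − δ) − 1 > R(γ) − κ/2 − 1`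
  have hSt := (abs_lt.1 (h (γ - δ) hδH)).1
  have hdist : dist (γ - δ) γ < δ₁ := by
    rw [Real.dist_eq, show γ - δ - γ = -δ by ring, abs_neg, abs_of_pos hδpos]; exact hδ₁'
  have hRv := hRc (Set.mem_Ici.2 hδH) hdist
  rw [Real.dist_eq] at hRv
  have hRv' := (abs_lt.1 hRv).1
  -- the variation of `θ`
  have hd : dist (γ - δ) γ < δ₀ := by
    rw [Real.dist_eq, show γ - δ - γ = -δ by ring, abs_neg, abs_of_pos hδpos]; exact hδ₀'
  have hθv := hθ (γ - δ) hd
  rw [Real.dist_eq] at hθv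
  have hθv' := (abs_lt.1 hθv).1
  have hX : (riemannSiegelTheta γ - riemannSiegelTheta (γ - δ)) / π < κ / 2 := by
    rw [div_lt_iff₀ Real.pi_pos]
    linarith
  have key := zetaArgS_sub (γ - δ) γ
  linarith

/-- (i) **Every continuous-reference pin splits**: `RefPin H R → RHAbove H` for `R` continuous on
`[H, ∞)`, `H ≥ 0` (an off-line zero `ρ` comes with `1 − conj ρ ≠ ρ` at the same ordinate: jump `≥ 2`). -/
theorem rhAbove_of_refPin {H : ℝ} {R : ℝ → ℝ} (hH : 0 ≤ H) (hR : ContinuousOn R (Set.Ici H))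
    (h : RefPin H R) : RHAbove H := by
  intro s hs hIm
  by_contra hre
  have h0 : 0 < s.im := hH.trans_lt hIm
  have him : s.im ≠ 0 := h0.ne'
  have hs' : riemannZeta (1 - starRingEnd ℂ s) = 0 := riemannZeta_one_sub_conj_eq_zero hs h0
  have him' : (1 - starRingEnd ℂ s).im = s.im := by simp
  have hres' : (1 - starRingEnd ℂ s).re = 1 - s.re := by simp
  have hne : s ≠ 1 - starRingEnd ℂ s := by
    intro hss
    apply hre
    have := congrArg Complex.re hss
    rw [hres'] at this
    linarith
  have hstrip := re_mem_Ioo_of_riemannZeta_eq_zero_of_im_ne_zero hs him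
  obtain ⟨δ, hδ, -, hlt⟩ := count_jump_lt_two_of_refPin hR h hIm
  have hjump := two_le_count_jump hs hs' hne him' h0 ⟨hstrip.1.le, hstrip.2.le⟩
    ⟨by rw [hres']; linarith [hstrip.2], by rw [hres']; linarith [hstrip.1]⟩
    (t := s.im - δ) (by linarith)
  linarith

/-- (i′) … and forces **simple zeros above `H`**: every zero of `ζ` with ordinate `> H` has order `1`. -/
theorem order_eq_one_of_refPin {H : ℝ} {R : ℝ → ℝ} (hH : 0 ≤ H) (hR : ContinuousOn R (Set.Ici H))
    (h : RefPin H R) {s : ℂ} (hs : riemannZeta s = 0) (hIm : H < s.im) :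
    riemannZetaZeroOrder s = 1 := by
  have h0 : 0 < s.im := hH.trans_lt hIm
  have hstrip := re_mem_Ioo_of_riemannZeta_eq_zero_of_im_ne_zero hs h0.ne'
  have h1 : (1 : ℤ) ≤ riemannZetaZeroOrder s := by
    have := (riemannZetaZeroOrder_pos_iff (ne_one_of_riemannZeta_eq_zero hs)).2 hs
    omega
  by_contra hne
  have h2 : (2 : ℤ) ≤ riemannZetaZeroOrder s := by omega
  obtain ⟨δ, hδ, -, hlt⟩ := count_jump_lt_two_of_refPin hR h hIm
  have hjump := two_le_count_jump_of_two_le_order hs h0 ⟨hstrip.1.le, hstrip.2.le⟩ h2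
    (t := s.im - δ) (by linarith)
  linarith

/-- So `riemannHypothesisUpTo_platt_trudgian ∧ RefPin 3000175332800 R → RH` for EVERY continuous reference `R` (valid, non-vacuous). -/
theorem rh_of_fin_of_refPin {R : ℝ → ℝ} (hR : ContinuousOn R (Set.Ici 3000175332800)) (hA : riemannHypothesisUpTo_platt_trudgian)
    (hB : RefPin 3000175332800 R) : RiemannHypothesis :=
  rh_of_fin_of_rhAbove hA (rhAbove_of_refPin (by norm_num) hR hB)

/-- (ii) **Kill by Selberg `Ω₊`**: a reference that is eventually bounded ABOVE cannot pin `S`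
(no continuity needed). -/
theorem not_refPin_of_eventually_le {H : ℝ} {R : ℝ → ℝ} (hM : ∃ M T : ℝ, ∀ t, T ≤ t → R t ≤ M) :
    ¬ RefPin H R := by
  rintro h
  obtain ⟨M, T, hMT⟩ := hM
  obtain ⟨t, ht, hlt⟩ := Selberg1946_zetaArgS_omega_holds.unbounded_above (M + 1) (max H T)
  have h1 := (abs_lt.1 (h t ((le_max_left _ _).trans ht))).2
  have h2 := hMT t ((le_max_right _ _).trans ht)
  linarith

/-- (ii′) **Kill by Selberg `Ω₋`**: a reference that is eventually bounded BELOW cannot pin `S`. -/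
theorem not_refPin_of_eventually_ge {H : ℝ} {R : ℝ → ℝ} (hM : ∃ M T : ℝ, ∀ t, T ≤ t → M ≤ R t) :
    ¬ RefPin H R := by
  rintro h
  obtain ⟨M, T, hMT⟩ := hM
  obtain ⟨t, ht, hlt⟩ := Selberg1946_zetaArgS_omega_holds.unbounded_below (M - 1) (max H T)
  have h1 := (abs_lt.1 (h t ((le_max_left _ _).trans ht))).1
  have h2 := hMT t ((le_max_right _ _).trans ht)
  linarith

/-- Instances: constant references (N7 is `c = 0`) … -/
theorem not_refPin_const (H c : ℝ) : ¬ RefPin H fun _ ↦ c :=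
  not_refPin_of_eventually_le ⟨c, 0, fun _ _ ↦ le_rfl⟩

/-- … references drifting to `+∞` (eventually bounded below) … -/
theorem not_refPin_of_tendsto_atTop {H : ℝ} {R : ℝ → ℝ} (hR : Tendsto R atTop atTop) :
    ¬ RefPin H R := by
  obtain ⟨T, hT⟩ := (tendsto_atTop_atTop.1 hR) 0
  exact not_refPin_of_eventually_ge ⟨0, T, hT⟩

/-- … references drifting to `−∞` … -/
theorem not_refPin_of_tendsto_atBot {H : ℝ} {R : ℝ → ℝ} (hR : Tendsto R atTop atBot) :
    ¬ RefPin H R := by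
  obtain ⟨T, hT⟩ := (tendsto_atTop_atBot.1 hR) 0
  exact not_refPin_of_eventually_le ⟨0, T, hT⟩

/-- … and the "mixed pin" of HANDOFF-g9: the value-side reference `c · arg ζ(σ₀ + i t)` (principal
argument, ANY abscissa `σ₀`, any scale `c`) is bounded by `|c| π`, hence refuted as a pin of `S`. -/
theorem not_refPin_arg (H σ₀ c : ℝ) :
    ¬ RefPin H fun t ↦ c * (riemannZeta (σ₀ + t * I)).arg := by
  refine not_refPin_of_eventually_le ⟨|c| * π, 0, fun t _ ↦ ?_⟩
  have h1 : |(riemannZeta (σ₀ + t * I)).arg| ≤ π := Complex.abs_arg_le_pi _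
  calc c * (riemannZeta (σ₀ + t * I)).arg ≤ |c * (riemannZeta (σ₀ + t * I)).arg| := le_abs_self _
    _ = |c| * |(riemannZeta (σ₀ + t * I)).arg| := abs_mul _ _
    _ ≤ |c| * π := mul_le_mul_of_nonneg_left h1 (abs_nonneg _)

/-- Summary of (ii): a pin can survive only if its reference is unbounded above AND below beyond
every height — i.e. oscillates in step with `S` itself. -/
theorem refPin_residue {H : ℝ} {R : ℝ → ℝ} (h : RefPin H R) :
    (∀ M T : ℝ, ∃ t, T ≤ t ∧ M < R t) ∧ (∀ M T : ℝ, ∃ t, T ≤ t ∧ R t < M) := by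
  constructor
  · intro M T
    by_contra hc
    push Not at hc
    exact not_refPin_of_eventually_le ⟨M, T, hc⟩ h
  · intro M T
    by_contra hc
    push Not at hc
    exact not_refPin_of_eventually_ge ⟨M, T, hc⟩ h

end Summit.RiemannHypothesis.RiemannHypothesis.Theorems.Splittings.ZdPrimePin

end
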